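import Summits.CriticalPhenomena.SAWScalingLimit.Theses.SAWLaplacianWalk
import Literature.Probability.RandomPlanarGeometry.SAWScalingLimitFamily

/-!
# Route SAWLaplacianWalk, support item `BoundaryApprox` (stmt-CriticalPhenomena-4486)

Every boundary point `d₀` of a Dobrushin domain `D = (Ω; a, b)` with an endpoint approximation
`(a_δ, b_δ)` admits lattice approximations `d_δ`, `δ · d_δ → d₀` as `δ → 0⁺`, joined to `a_δ` in
the discrete domain `Ω_δ = discreteDomainGraph Ω δ` for all small `δ`.

Proof: the construction of `SAW.exists_isEndpointApprox` run at the third point. Interior points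
`z n → d₀` with closed discs `B̄(z n, r n) ⊆ Ω`; by the bulk theorem
`JordanDomain.exists_forall_mem_meshDomain_and_reachable` (the largest mesh component of EVERY
Jordan domain is the bulk, `MeshDomainJordan.lean`), below a stage threshold the site nearest to
`z n` lies in `Ω_δ`, which is then a single mesh component; the diagonal stage selection
`exists_stage_tendsto_atTop` gives `d δ := nearestSite δ (z (N δ))`; finally `a δ ∈ Ω_δ` for small
`δ` because `a δ` is joined to `b δ ≠ a δ` (`D.pt 0 ≠ D.pt 1`).
-/

namespace Summit.CriticalPhenomena.SAWScalingLimit.Theorems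

open Filter Topology Metric Set
open Literature.Probability.LatticeModels Literature.Probability.RandomPlanarGeometry

/-- Two families of lattice sites whose mesh points converge, along `δ → 0⁺`, to two distinct
points are eventually distinct. [folklore] -/
theorem SAWLaplacianWalk.eventually_ne_of_tendsto_meshPoint {a b : ℝ → Site 2} {p q : ℂ}
    (hpq : p ≠ q) (ha : Tendsto (fun δ => meshPoint δ (a δ)) (𝓝[>] (0 : ℝ)) (𝓝 p))
    (hb : Tendsto (fun δ => meshPoint δ (b δ)) (𝓝[>] (0 : ℝ)) (𝓝 q)) :
    ∀ᶠ δ in 𝓝[>] (0 : ℝ), a δ ≠ b δ := by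
  have hd : 0 < dist p q / 2 := half_pos (dist_pos.2 hpq)
  filter_upwards [Metric.tendsto_nhds.1 ha _ hd, Metric.tendsto_nhds.1 hb _ hd] with δ h1 h2 heq
  rw [heq] at h1
  have := dist_triangle_left p q (meshPoint δ (b δ))
  linarith

/-- **Support item `BoundaryApprox` of route SAWLaplacianWalk** (stmt-CriticalPhenomena-4486):
every boundary point `d₀ ∈ ∂Ω` of a Dobrushin domain with an endpoint approximation `(a_δ, b_δ)`
admits lattice approximations `d_δ` with `δ · d_δ → d₀` (`δ → 0⁺`) that are joined to `a_δ` in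
`Ω_δ` for all small `δ` (the largest component of `δℤ² ∩ Ω` exhausts `Ω`,
`JordanDomain.exists_forall_mem_meshDomain_and_reachable`). [folklore] -/
theorem boundaryApprox_proof :
    Summit.CriticalPhenomena.SAWScalingLimit.Theses.SAWLaplacianWalk.BoundaryApprox := by
  intro D a b hab d₀ hd₀
  classical
  -- interior points `z n → d₀` with closed discs of radius `r n` inside `Ω`
  have hz : ∀ n : ℕ, ∃ z ∈ D.carrier, dist z d₀ < 1 / ((n : ℝ) + 1) ∧
      ∃ r > 0, closedBall z r ⊆ D.carrier := by
    intro n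
    obtain ⟨z, hz, hd⟩ := Metric.mem_closure_iff.1 (frontier_subset_closure hd₀)
      (1 / ((n : ℝ) + 1)) (by positivity)
    obtain ⟨r, hr, hsub⟩ := Metric.isOpen_iff.1 D.isOpen z hz
    exact ⟨z, hz, by rwa [dist_comm], r / 2, by positivity,
      (closedBall_subset_ball (by linarith)).trans hsub⟩
  choose z _hzΩ hzd r hr hrΩ using hz
  -- stage `n`: the bulk theorem for the compact disc `B̄(z n, r n)`
  have hstage := fun n => D.toJordanDomain.exists_forall_mem_meshDomain_and_reachable
    (isCompact_closedBall (z n) (r n)) (hrΩ n)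
  choose δ₀ hδ₀ hgood using hstage
  -- diagonal stage selection
  obtain ⟨N, hN, hNtop⟩ := exists_stage_tendsto_atTop
    (p := fun n δ => 0 < δ ∧ δ < min (δ₀ n) (r n)) (ε := fun n => min (δ₀ n) (r n))
    (fun n => lt_min (hδ₀ n) (hr n)) (fun n δ h₁ h₂ => ⟨h₁, h₂⟩)
  refine ⟨fun δ => nearestSite δ (z (N δ)), tendsto_meshPoint_nearestSite_of_tendsto hzd hNtop, ?_⟩
  -- `a δ ≠ b δ` eventually, hence `a δ ∈ Ω_δ` eventually
  have hne : ∀ᶠ δ in 𝓝[>] (0 : ℝ), a δ ≠ b δ :=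
    SAWLaplacianWalk.eventually_ne_of_tendsto_meshPoint
      (D.pt_injective.ne (by decide : (0 : Fin 2) ≠ 1)) hab.tendsto_fst hab.tendsto_snd
  filter_upwards [hN, hab.reachable, hne] with δ hNδ hreach hne'
  obtain ⟨hδ, hlt⟩ := hNδ
  have ha : a δ ∈ meshDomain D.carrier δ := by
    obtain ⟨p⟩ := hreach
    obtain ⟨w, hadj, _, _⟩ := p.exists_eq_cons_of_ne hne'
    exact (discreteDomainGraph_adj_iff.1 hadj).2.1
  obtain ⟨hin, hconn⟩ := hgood (N δ) δ hδ (hlt.trans_le (min_le_left _ _))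
  have hd : nearestSite δ (z (N δ)) ∈ meshDomain D.carrier δ :=
    hin _ (mem_closedBall.2 ((dist_meshPoint_nearestSite_le hδ _).trans
      (hlt.trans_le (min_le_right _ _)).le))
  obtain ⟨_, _, ⟨q⟩⟩ := hconn _ ha _ hd
  exact reachable_discreteDomainGraph_of_walk q ha

end Summit.CriticalPhenomena.SAWScalingLimit.Theorems
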